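import Summits.HodgeConjecture.HodgeConjecture.Cruxes.BlochSeedDiscOne.SigmaH
import Summits.HodgeConjecture.HodgeConjecture.Cruxes.BlochSeedDiscOne.MinMassWindowH14
import Summits.HodgeConjecture.HodgeConjecture.Cruxes.BlochSeedDiscOne.AxisPhaseTorus

/-!
line stmt-HodgeConjecture-18881 Cruxes/BlochSeedDiscOne/Lines/birth.lean 814a6a70c14e831a stub_rung_pad4_seedAt

# AxisRuleDCheap — RULE-D CLOSURE IS CHEAP: an explicit single-ray AXIS design `C⋆` with `RuleD`, `Disj`, `HallUp`, `HallPlusUp 8`,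
# `μ = −7 ≠ 0`, N-mass 49 ≤ 58 and the Σ-budget of record — violating ONLY (A1).  Completes the attribution on the axis road:
# each of (A1), `RuleD`, Σ-budget is NECESSARY for the door (`C⋆`, `D⋆(24)`, `R⋆`), and together they are SUFFICIENT (`AxisSPlus`).
(plan-lens-HodgeAV-strengthen g21, 2026-08-31; STRENGTHEN-MEMO-31 §3; S⁺-ledger v1.44.)

HONESTY LABEL.  Letter-model statements about `DepthBoundA4.Design` only (letters ≠ sheaves ≠ monads ≠ SEED).  NOTHING here is proved
toward HC ∕ HC_CM ∕ HC_AV ∕ №4 ∕ 26512 ∕ 18881 ∕ H2; no rung, no shell of `SPlus 14 sigmaH 0` is closed.  CENSUS-NEUTRAL: `C⋆` is NOT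
(A1)-clean (certified below), so it inhabits nothing of record; it is kernel EVIDENCE about which binder carries the axis-road theorem
`AxisSPlus.sPlusB_axisRoom_budget`: its N-MASS LAW `nmass_ge_59` («axis room ∧ Disj ∧ (A1) ∧ RuleD ∧ μ ≠ 0 ⇒ Σ_N m ≥ 59») genuinely needs
(A1) — RULE D + Disj + μ ≠ 0 alone allow `Σ_N m = 49` (in fact 19 without the Hall hubs).

THE DESIGN `C⋆` (§2), height 14, ONE RAY (phase 0; letters `H = (14;0,0)`, `u = (13;1,0)`, `v = (12;2,0)`, null steps `v → u → H`, `v → H`),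
written by co-level vectors: N-side `30·H⁴`, `1111` (= u⁴), the 12 permutations of `2100`, the 6 of `1100` (19 charged-or-mixed cells, mass 19);
P-side the 4 permutations of `2111`, the 6 of `2200`, the 12 of `2110` (22 cells, mass 22).  It is the closure of the single hub-free N-cell
`u⁴` under the two RULE-D clauses with the cheapest choices (found by hand, memo-31 §3; `eng/cheapC.py` mirrors every number below).
KERNEL CERTIFICATE (§3; `decide +kernel` tables over the 42 entries + the boiler-plate of `MinMassWindowH14` by import; a SOUND raw RULE-D
checker `ruleD_of_B` in §1): `OnAlphabet 14`, `AxisRoom`, `Disj`, **`RuleD`**, `HallUp`, `HallPlusUp 8` (heavy hub: `22 + 8 ≤ 30`),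
`μ = T(eeee) = −7 ≠ 0`, `rank = 27`, `copies = 71`, N-mass `49`, `Σ-H = 28·71 = 1988` (all four ext digits `0`), `BudgetClause sigmaH 0`
(`1988 + 28·23 = 2632 ≤ 3136`), and **`¬ (A1)`** (the mixed word `1·1·1·e` evaluates to `−10 ≠ 0`).  §4 transports `C⋆` to every height
`h ≥ 2`.  PROVENANCE (irrelevant to validity): hand construction + `eng/cheapC.py` (stdlib Python).  `decide +kernel` only: no `native_decide`,
no `sorry`, no `axiom`, no `instance`, no notation, no Literature fact, no `allowUnsafeReducibility`.
-/

set_option linter.dupNamespace false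
set_option autoImplicit false
set_option maxRecDepth 16384
set_option maxHeartbeats 8000000

namespace Summit.HodgeConjecture.HodgeConjecture.Cruxes.BlochSeedDiscOne.AxisRuleDCheap

open Summit.HodgeConjecture.HodgeConjecture.Cruxes.BlochSeedDiscOne.DepthBoundA4
open Summit.HodgeConjecture.HodgeConjecture.Cruxes.BlochSeedDiscOne.HeightTower
open Summit.HodgeConjecture.HodgeConjecture.Cruxes.BlochSeedDiscOne.LeggedFloor (NullStep Supplies Detects RuleDP RuleD Disj)
open Summit.HodgeConjecture.HodgeConjecture.Cruxes.BlochSeedDiscOne.HallB136 (HallUp notDeadB weakLiveB weakLiveB_of)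
open Summit.HodgeConjecture.HodgeConjecture.Cruxes.BlochSeedDiscOne.RuleDPlate
  (HallPlusUp hallUp_of_hallPlusUp hallUp_shiftD hallPlusUp_shiftD disj_shiftD ruleD_shiftD BudgetClause budgetClause_shiftD SPlusB SPlus)
open Summit.HodgeConjecture.HodgeConjecture.Cruxes.BlochSeedDiscOne.SigmaH (sigmaH extPN extNP extNN extPP sigmaH_shiftD)
open Summit.HodgeConjecture.HodgeConjecture.Cruxes.BlochSeedDiscOne.MinMassWindowH14
  (toG rawT T_raw allB allB_iff anyB anyB_iff cellOf allWords mem_allWords onAlphaB onAlphabet_of_B mem_suppN_of mem_suppP_of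
   exists_of_mem_suppN exists_of_mem_suppP cellEqB cellEqB_self nullStepB stepB fins mem_fins suppliesB suppliesB_of)
open Summit.HodgeConjecture.HodgeConjecture.Cruxes.BlochSeedDiscOne.AxisPhaseTorus (AxisCell AxisRoom)

/-! ## §1 Generic lemmas: SOUNDNESS of the raw supplier test, a raw RULE-D checker, the heavy-hub surplus lemma -/

theorem nullStep_of_B {ℓ ℓ' : Letter} (h : nullStepB ℓ ℓ' = true) : NullStep ℓ ℓ' := by
  simp only [nullStepB, Bool.and_eq_true, decide_eq_true_eq] at h
  exact ⟨h.1, h.2⟩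

theorem step_of_B {ℓ ℓ' : Letter} (h : stepB ℓ ℓ' = true) : ℓ = ℓ' ∨ NullStep ℓ ℓ' := by
  simp only [stepB, Bool.or_eq_true, decide_eq_true_eq] at h
  rcases h with h | h
  · exact Or.inl h
  · exact Or.inr (nullStep_of_B h)

/-- the raw supplier test is SOUND (its completeness `suppliesB_of` is `MinMassWindowH14`'s). -/
theorem supplies_of_B {x y : Cell} {g j : Fin 4} (h : suppliesB x y g j = true) : Supplies x y g j := by
  simp only [suppliesB, Bool.and_eq_true] at h
  obtain ⟨⟨hoff, hg⟩, hj⟩ := h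
  refine ⟨?_, step_of_B hg, step_of_B hj⟩
  intro f hfg hfj
  have hf := (allB_iff _ _).1 hoff f (mem_fins f)
  simp only [Bool.or_eq_true, decide_eq_true_eq] at hf
  rcases hf with (hf | hf) | hf
  · exact absurd hf hfg
  · exact absurd hf hfj
  · exact hf

/-- raw DETECTS test. -/
def detectsB (c : Cell) (g j : Fin 4) : Bool :=
  !(decide ((c g).x = 0) && decide ((c g).y = 0) && decide ((c j).x = 0) && decide ((c j).y = 0) && decide ((c g).a = (c j).a))

theorem detectsB_of {c : Cell} {g j : Fin 4} (h : Detects c g j) : detectsB c g j = true := by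
  unfold Detects at h
  simp only [detectsB, Bool.not_eq_true', Bool.and_eq_false_iff, decide_eq_false_iff_not]
  by_contra hc
  simp only [not_or, not_not] at hc
  exact h ⟨hc.1.1.1.1, hc.1.1.1.2, hc.1.1.2, hc.1.2, hc.2⟩

/-- the six blocks `g < j`. -/
def blocks : List (Fin 4 × Fin 4) := [(0, 1), (0, 2), (0, 3), (1, 2), (1, 3), (2, 3)]

theorem mem_blocks : ∀ g j : Fin 4, g < j → (g, j) ∈ blocks := by decide

/-- raw RULE-D checker: every entry of `X` whose block detects has, among the POSITIVE-mass entries of `Y`, a raw supplier (N-side: `Y` above;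
P-side: `Y` below — the direction is carried by the test passed in). -/
def closedB (X Y : List (Cell × ℕ)) (t : Cell → Cell → Fin 4 → Fin 4 → Bool) : Bool :=
  allB X fun cx => allB blocks fun b => !detectsB cx.1 b.1 b.2 || anyB Y fun cy => decide (0 < cy.2) && t cy.1 cx.1 b.1 b.2

/-- SOUNDNESS of the raw RULE-D checker. -/
theorem ruleD_of_B (E : Design)
    (hN : closedB E.N E.P (fun x y g j => suppliesB x y g j) = true)
    (hP : closedB E.P E.N (fun y x g j => suppliesB x y g j) = true) : RuleD E := by
  constructor
  · intro y hy g j hgj hdet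
    obtain ⟨m, hm⟩ := exists_of_mem_suppN hy
    have h1 := (allB_iff _ _).1 ((allB_iff _ _).1 hN (y, m) hm) (g, j) (mem_blocks g j hgj)
    simp only [Bool.or_eq_true, Bool.not_eq_true', detectsB_of hdet] at h1
    rcases h1 with h1 | h1
    · exact Bool.noConfusion h1
    · obtain ⟨cx, hcx, hb⟩ := (anyB_iff _ _).1 h1
      simp only [Bool.and_eq_true, decide_eq_true_eq] at hb
      exact ⟨cx.1, mem_suppP_of (by simpa using hcx) hb.1, supplies_of_B hb.2⟩
  · intro x hx g j hgj hdet
    obtain ⟨m, hm⟩ := exists_of_mem_suppP hx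
    have h1 := (allB_iff _ _).1 ((allB_iff _ _).1 hP (x, m) hm) (g, j) (mem_blocks g j hgj)
    simp only [Bool.or_eq_true, Bool.not_eq_true', detectsB_of hdet] at h1
    rcases h1 with h1 | h1
    · exact Bool.noConfusion h1
    · obtain ⟨cy, hcy, hb⟩ := (anyB_iff _ _).1 h1
      simp only [Bool.and_eq_true, decide_eq_true_eq] at hb
      exact ⟨cy.1, mem_suppN_of (by simpa using hcy) hb.1, supplies_of_B hb.2⟩

theorem notDead_of_notDeadB {ℓ ℓ' : Letter} (h : notDeadB ℓ ℓ' = true) : NotDead ℓ ℓ' := by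
  simp only [notDeadB, Bool.or_eq_true, Bool.and_eq_true, decide_eq_true_eq] at h
  rcases h with ⟨⟨ha, hx⟩, hy⟩ | ⟨ha, hb⟩
  · left
    obtain ⟨a, x, y⟩ := ℓ
    obtain ⟨a', x', y'⟩ := ℓ'
    simp only at ha hx hy
    subst ha; subst hx; subst hy
    rfl
  · right
    exact ⟨ha, by simpa only [pow_two] using hb⟩

theorem weakLive_of_weakLiveB {x y : Cell} (h : weakLiveB x y = true) : WeakLive x y := by
  simp only [weakLiveB, Bool.and_eq_true] at h
  obtain ⟨⟨⟨h0, h1⟩, h2⟩, h3⟩ := h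
  intro f
  fin_cases f
  · exact notDead_of_notDeadB h0
  · exact notDead_of_notDeadB h1
  · exact notDead_of_notDeadB h2
  · exact notDead_of_notDeadB h3

/-- HEAVY-HUB SURPLUS LEMMA (as in `AxisRoomInhabitant24`): one N-entry weakly above every P-entry with multiplicity ≥ P-mass + `k` gives `HallPlusUp E k`. -/
theorem hallPlusUp_of_heavy_entry (E : Design) (k : ℕ) (e : Cell × ℕ) (he : e ∈ E.N)
    (habove : ∀ cm ∈ E.P, WeakLive cm.1 e.1) (hmass : (E.P.map Prod.snd).sum + k ≤ e.2) : HallPlusUp E k := by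
  intro S hS hpos T hT hcov
  obtain ⟨cm, hcm⟩ : ∃ cm, cm ∈ S := by
    cases S with
    | nil => simp at hpos
    | cons a l => exact ⟨a, List.mem_cons_self⟩
  have heT : e ∈ T := hcov e he ⟨cm, hcm, habove cm (hS.subset hcm)⟩
  have h1 : (S.map Prod.snd).sum ≤ (E.P.map Prod.snd).sum :=
    (hS.map Prod.snd).sum_le_sum (fun a _ => Nat.zero_le a)
  have h2 : e.2 ≤ (T.map Prod.snd).sum :=
    List.single_le_sum (fun a _ => Nat.zero_le a) e.2 (List.mem_map.2 ⟨e, heT, rfl⟩)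
  omega

/-! ## §2 The design `C⋆` at height 14 (42 entries; N-mass 49, P-mass 22) -/

def CN : List (Cell × ℕ) := [
  (cellOf ⟨14, 0, 0⟩ ⟨14, 0, 0⟩ ⟨14, 0, 0⟩ ⟨14, 0, 0⟩, 30),
  (cellOf ⟨13, 1, 0⟩ ⟨13, 1, 0⟩ ⟨13, 1, 0⟩ ⟨13, 1, 0⟩, 1),
  (cellOf ⟨12, 2, 0⟩ ⟨13, 1, 0⟩ ⟨14, 0, 0⟩ ⟨14, 0, 0⟩, 1),
  (cellOf ⟨12, 2, 0⟩ ⟨14, 0, 0⟩ ⟨13, 1, 0⟩ ⟨14, 0, 0⟩, 1),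
  (cellOf ⟨12, 2, 0⟩ ⟨14, 0, 0⟩ ⟨14, 0, 0⟩ ⟨13, 1, 0⟩, 1),
  (cellOf ⟨13, 1, 0⟩ ⟨12, 2, 0⟩ ⟨14, 0, 0⟩ ⟨14, 0, 0⟩, 1),
  (cellOf ⟨13, 1, 0⟩ ⟨14, 0, 0⟩ ⟨12, 2, 0⟩ ⟨14, 0, 0⟩, 1),
  (cellOf ⟨13, 1, 0⟩ ⟨14, 0, 0⟩ ⟨14, 0, 0⟩ ⟨12, 2, 0⟩, 1),
  (cellOf ⟨14, 0, 0⟩ ⟨12, 2, 0⟩ ⟨13, 1, 0⟩ ⟨14, 0, 0⟩, 1),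
  (cellOf ⟨14, 0, 0⟩ ⟨12, 2, 0⟩ ⟨14, 0, 0⟩ ⟨13, 1, 0⟩, 1),
  (cellOf ⟨14, 0, 0⟩ ⟨13, 1, 0⟩ ⟨12, 2, 0⟩ ⟨14, 0, 0⟩, 1),
  (cellOf ⟨14, 0, 0⟩ ⟨13, 1, 0⟩ ⟨14, 0, 0⟩ ⟨12, 2, 0⟩, 1),
  (cellOf ⟨14, 0, 0⟩ ⟨14, 0, 0⟩ ⟨12, 2, 0⟩ ⟨13, 1, 0⟩, 1),
  (cellOf ⟨14, 0, 0⟩ ⟨14, 0, 0⟩ ⟨13, 1, 0⟩ ⟨12, 2, 0⟩, 1),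
  (cellOf ⟨13, 1, 0⟩ ⟨13, 1, 0⟩ ⟨14, 0, 0⟩ ⟨14, 0, 0⟩, 1),
  (cellOf ⟨13, 1, 0⟩ ⟨14, 0, 0⟩ ⟨13, 1, 0⟩ ⟨14, 0, 0⟩, 1),
  (cellOf ⟨13, 1, 0⟩ ⟨14, 0, 0⟩ ⟨14, 0, 0⟩ ⟨13, 1, 0⟩, 1),
  (cellOf ⟨14, 0, 0⟩ ⟨13, 1, 0⟩ ⟨13, 1, 0⟩ ⟨14, 0, 0⟩, 1),
  (cellOf ⟨14, 0, 0⟩ ⟨13, 1, 0⟩ ⟨14, 0, 0⟩ ⟨13, 1, 0⟩, 1),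
  (cellOf ⟨14, 0, 0⟩ ⟨14, 0, 0⟩ ⟨13, 1, 0⟩ ⟨13, 1, 0⟩, 1)]

def CP : List (Cell × ℕ) := [
  (cellOf ⟨12, 2, 0⟩ ⟨13, 1, 0⟩ ⟨13, 1, 0⟩ ⟨13, 1, 0⟩, 1),
  (cellOf ⟨13, 1, 0⟩ ⟨12, 2, 0⟩ ⟨13, 1, 0⟩ ⟨13, 1, 0⟩, 1),
  (cellOf ⟨13, 1, 0⟩ ⟨13, 1, 0⟩ ⟨12, 2, 0⟩ ⟨13, 1, 0⟩, 1),
  (cellOf ⟨13, 1, 0⟩ ⟨13, 1, 0⟩ ⟨13, 1, 0⟩ ⟨12, 2, 0⟩, 1),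
  (cellOf ⟨12, 2, 0⟩ ⟨12, 2, 0⟩ ⟨14, 0, 0⟩ ⟨14, 0, 0⟩, 1),
  (cellOf ⟨12, 2, 0⟩ ⟨14, 0, 0⟩ ⟨12, 2, 0⟩ ⟨14, 0, 0⟩, 1),
  (cellOf ⟨12, 2, 0⟩ ⟨14, 0, 0⟩ ⟨14, 0, 0⟩ ⟨12, 2, 0⟩, 1),
  (cellOf ⟨14, 0, 0⟩ ⟨12, 2, 0⟩ ⟨12, 2, 0⟩ ⟨14, 0, 0⟩, 1),
  (cellOf ⟨14, 0, 0⟩ ⟨12, 2, 0⟩ ⟨14, 0, 0⟩ ⟨12, 2, 0⟩, 1),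
  (cellOf ⟨14, 0, 0⟩ ⟨14, 0, 0⟩ ⟨12, 2, 0⟩ ⟨12, 2, 0⟩, 1),
  (cellOf ⟨12, 2, 0⟩ ⟨13, 1, 0⟩ ⟨13, 1, 0⟩ ⟨14, 0, 0⟩, 1),
  (cellOf ⟨12, 2, 0⟩ ⟨13, 1, 0⟩ ⟨14, 0, 0⟩ ⟨13, 1, 0⟩, 1),
  (cellOf ⟨12, 2, 0⟩ ⟨14, 0, 0⟩ ⟨13, 1, 0⟩ ⟨13, 1, 0⟩, 1),
  (cellOf ⟨13, 1, 0⟩ ⟨12, 2, 0⟩ ⟨13, 1, 0⟩ ⟨14, 0, 0⟩, 1),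
  (cellOf ⟨13, 1, 0⟩ ⟨12, 2, 0⟩ ⟨14, 0, 0⟩ ⟨13, 1, 0⟩, 1),
  (cellOf ⟨13, 1, 0⟩ ⟨13, 1, 0⟩ ⟨12, 2, 0⟩ ⟨14, 0, 0⟩, 1),
  (cellOf ⟨13, 1, 0⟩ ⟨13, 1, 0⟩ ⟨14, 0, 0⟩ ⟨12, 2, 0⟩, 1),
  (cellOf ⟨13, 1, 0⟩ ⟨14, 0, 0⟩ ⟨12, 2, 0⟩ ⟨13, 1, 0⟩, 1),
  (cellOf ⟨13, 1, 0⟩ ⟨14, 0, 0⟩ ⟨13, 1, 0⟩ ⟨12, 2, 0⟩, 1),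
  (cellOf ⟨14, 0, 0⟩ ⟨12, 2, 0⟩ ⟨13, 1, 0⟩ ⟨13, 1, 0⟩, 1),
  (cellOf ⟨14, 0, 0⟩ ⟨13, 1, 0⟩ ⟨12, 2, 0⟩ ⟨13, 1, 0⟩, 1),
  (cellOf ⟨14, 0, 0⟩ ⟨13, 1, 0⟩ ⟨13, 1, 0⟩ ⟨12, 2, 0⟩, 1)]

/-- `C⋆` at height 14. -/
def Cstar : Design := ⟨CN, CP⟩

/-- the hub entry. -/
def hub4 : Cell := cellOf ⟨14, 0, 0⟩ ⟨14, 0, 0⟩ ⟨14, 0, 0⟩ ⟨14, 0, 0⟩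

theorem hubE_mem : (hub4, 30) ∈ Cstar.N := List.mem_cons_self

/-- the hub-free N-cell `u⁴` whose closure `C⋆` is. -/
def u4 : Cell := cellOf ⟨13, 1, 0⟩ ⟨13, 1, 0⟩ ⟨13, 1, 0⟩ ⟨13, 1, 0⟩

theorem u4_mem : (u4, 1) ∈ Cstar.N := List.mem_cons_of_mem _ List.mem_cons_self

/-! ## §3 The certificate (kernel tables) -/

theorem alphaCN : allB CN (fun cm => onAlphaB 14 cm.1) = true := by decide +kernel
theorem alphaCP : allB CP (fun cm => onAlphaB 14 cm.1) = true := by decide +kernel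

/-- every letter of `C⋆` has level `≥ 12`. -/
def levB (c : Cell) : Bool := decide (12 ≤ (c 0).a) && decide (12 ≤ (c 1).a) && decide (12 ≤ (c 2).a) && decide (12 ≤ (c 3).a)

theorem levCN : allB CN (fun cm => levB cm.1) = true := by decide +kernel
theorem levCP : allB CP (fun cm => levB cm.1) = true := by decide +kernel

theorem disjC_table : allB CN (fun cn => allB CP (fun cm => !cellEqB cm.1 cn.1)) = true := by decide +kernel

/-- raw axis test of a cell. -/
def axisB (c : Cell) : Bool :=
  decide ((c 0).x * (c 0).y = 0) && decide ((c 1).x * (c 1).y = 0) && decide ((c 2).x * (c 2).y = 0) && decide ((c 3).x * (c 3).y = 0)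

theorem axisCN : allB CN (fun cm => axisB cm.1) = true := by decide +kernel
theorem axisCP : allB CP (fun cm => axisB cm.1) = true := by decide +kernel

/-- **RULE D, both clauses, raw** (every detecting block of every entry has a positive-mass supplier ∕ supplied cell on the other side). -/
theorem closedN_C : closedB CN CP (fun x y g j => suppliesB x y g j) = true := by decide +kernel
theorem closedP_C : closedB CP CN (fun y x g j => suppliesB x y g j) = true := by decide +kernel

theorem hub_above_P : allB CP (fun cm => weakLiveB cm.1 hub4) = true := by decide +kernel

theorem mu_rawC : rawT CN CP Word.eeee = (-7, 0) := by decide +kernel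
theorem copies_C : Cstar.copies = 71 := by decide +kernel
theorem rank_C : Cstar.rank = 27 := by decide +kernel
theorem massP_C : (Cstar.P.map Prod.snd).sum = 22 := by decide +kernel
theorem massN_C : (Cstar.N.map Prod.snd).sum = 49 := by decide +kernel

theorem extPN_C_one : extPN Cstar 1 = 0 := by decide +kernel
theorem extNP_C_three : extNP Cstar 3 = 0 := by decide +kernel
theorem extNN_C_two : extNN Cstar 2 = 0 := by decide +kernel
theorem extPP_C_two : extPP Cstar 2 = 0 := by decide +kernel

/-- the (A1)-violating mixed word `1·1·1·e`. -/
def w1e : Word := ![Sym.one, Sym.one, Sym.one, Sym.e]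

theorem raw_w1e : rawT CN CP w1e = (-10, 0) := by decide +kernel

/-! ### the certificate in words -/

theorem onAlphabet_C : Cstar.OnAlphabet 14 := by
  intro c hc f
  rcases List.mem_append.1 hc with hN | hP
  · obtain ⟨m, hm⟩ := exists_of_mem_suppN hN
    exact onAlphabet_of_B ((allB_iff _ _).1 alphaCN (c, m) hm) f
  · obtain ⟨m, hm⟩ := exists_of_mem_suppP hP
    exact onAlphabet_of_B ((allB_iff _ _).1 alphaCP (c, m) hm) f

theorem axisCell_of_B {c : Cell} (hc : axisB c = true) : AxisCell c := by
  simp only [axisB, Bool.and_eq_true, decide_eq_true_eq] at hc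
  obtain ⟨⟨⟨h0, h1⟩, h2⟩, h3⟩ := hc
  intro f
  fin_cases f
  · exact h0
  · exact h1
  · exact h2
  · exact h3

theorem axisRoom_C : AxisRoom Cstar := by
  intro c hc
  rcases List.mem_append.1 hc with hN | hP
  · obtain ⟨m, hm⟩ := exists_of_mem_suppN hN
    exact axisCell_of_B ((allB_iff _ _).1 axisCN (c, m) hm)
  · obtain ⟨m, hm⟩ := exists_of_mem_suppP hP
    exact axisCell_of_B ((allB_iff _ _).1 axisCP (c, m) hm)

theorem level_of_B {c : Cell} (hc : levB c = true) : ∀ f : Fin 4, 12 ≤ (c f).a := by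
  simp only [levB, Bool.and_eq_true, decide_eq_true_eq] at hc
  obtain ⟨⟨⟨h0, h1⟩, h2⟩, h3⟩ := hc
  intro f
  fin_cases f
  · exact h0
  · exact h1
  · exact h2
  · exact h3

theorem level_C : ∀ c ∈ Cstar.suppN ++ Cstar.suppP, ∀ f : Fin 4, 12 ≤ (c f).a := by
  intro c hc f
  rcases List.mem_append.1 hc with hN | hP
  · obtain ⟨m, hm⟩ := exists_of_mem_suppN hN
    exact level_of_B ((allB_iff _ _).1 levCN (c, m) hm) f
  · obtain ⟨m, hm⟩ := exists_of_mem_suppP hP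
    exact level_of_B ((allB_iff _ _).1 levCP (c, m) hm) f

theorem disj_C : Disj Cstar := by
  intro c hN hP
  obtain ⟨n, hn⟩ := exists_of_mem_suppN hN
  obtain ⟨m, hm⟩ := exists_of_mem_suppP hP
  have h1 := (allB_iff _ _).1 ((allB_iff _ _).1 disjC_table (c, n) hn) (c, m) hm
  rw [cellEqB_self] at h1
  exact Bool.noConfusion h1

/-- **`C⋆` satisfies RULE D** (both clauses). -/
theorem ruleD_C : RuleD Cstar := ruleD_of_B Cstar closedN_C closedP_C

theorem T_closedC (w : Word) : Cstar.T w = toG (rawT CN CP w) := T_raw Cstar w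

theorem mu_C : Cstar.mu = ⟨-7, 0⟩ := by
  show Cstar.T Word.eeee = _
  rw [T_closedC, mu_rawC]
  rfl

theorem mu_ne_C : Cstar.mu ≠ 0 := by
  rw [mu_C]
  decide

theorem hub_above (cm : Cell × ℕ) (hcm : cm ∈ Cstar.P) : WeakLive cm.1 hub4 :=
  weakLive_of_weakLiveB ((allB_iff _ _).1 hub_above_P cm hcm)

/-- PortHall₈ by the heavy hub: `22 + 8 ≤ 30`. -/
theorem hallPlusUp8_C : HallPlusUp Cstar 8 :=
  hallPlusUp_of_heavy_entry Cstar 8 (hub4, 30) hubE_mem hub_above (by rw [massP_C])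

theorem hallUp_C : HallUp Cstar := hallUp_of_hallPlusUp Cstar 8 hallPlusUp8_C

theorem sigmaH_C : sigmaH Cstar = 1988 := by
  unfold sigmaH
  rw [copies_C, extPN_C_one, extNP_C_three, extNN_C_two, extPP_C_two]
  norm_num

/-- the Σ-budget of record holds: `1988 + 28·(27 − 4) + 0 = 2632 ≤ 3136`. -/
theorem budget_C : BudgetClause sigmaH 0 Cstar := by
  unfold BudgetClause
  rw [sigmaH_C, rank_C]
  norm_num

/-- N-mass `49 ≤ 58`: `C⋆` sits INSIDE the N-mass budget that `AxisSPlus.nmass_le_58_of_budget` extracts, and below the bound `59` of `AxisSPlus.nmass_ge_59`. -/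
theorem nmass_C : (Cstar.N.map Prod.snd).sum = 49 ∧ (Cstar.N.map Prod.snd).sum ≤ 58 := by
  rw [massN_C]; exact ⟨rfl, by norm_num⟩

theorem T_w1e_C : Cstar.T w1e = ⟨-10, 0⟩ := by
  rw [T_closedC, raw_w1e]
  rfl

/-- **`C⋆` is NOT (A1)-clean**: the mixed word `1·1·1·e` does not vanish. -/
theorem not_a1_C : ¬ Cstar.A1 := by
  intro h
  have hmv := ((a1_iff Cstar).1 h).1
  have hne : ¬ w1e.efree := fun he => absurd (he 3) (by decide)
  have h1 : w1e ≠ Word.eeee := fun he => absurd (congrFun he 0) (by decide)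
  have h2 : w1e ≠ Word.EEEE := fun he => absurd (congrFun he 0) (by decide)
  have h0 := hmv w1e hne h1 h2
  rw [T_w1e_C] at h0
  exact absurd h0 (by decide)

/-- **THE CERTIFICATE OF `C⋆`**: every binder of the S⁺ sentence of record in the axis room — `RuleD` and the Σ-budget INCLUDED — except (A1). -/
theorem cert_C : Cstar.OnAlphabet 14 ∧ AxisRoom Cstar ∧ Disj Cstar ∧ RuleD Cstar ∧ HallUp Cstar ∧ HallPlusUp Cstar 8 ∧
    Cstar.mu = ⟨-7, 0⟩ ∧ Cstar.rank = 27 ∧ Cstar.copies = 71 ∧ (Cstar.N.map Prod.snd).sum = 49 ∧ BudgetClause sigmaH 0 Cstar ∧ ¬ Cstar.A1 :=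
  ⟨onAlphabet_C, axisRoom_C, disj_C, ruleD_C, hallUp_C, hallPlusUp8_C, mu_C, rank_C, copies_C, massN_C, budget_C, not_a1_C⟩

/-! ## §4 Every height `h ≥ 2` -/

/-- `C⋆` moved to height `h` (letters have level ≥ 12 at height 14, so any `h ≥ 2` works). -/
def CstarAt (h : ℤ) : Design := shiftD (h - 14) Cstar

theorem onAlphabet_CstarAt {h : ℤ} (hh : 2 ≤ h) : (CstarAt h).OnAlphabet h := by
  have e : h = 14 + (h - 14) := by ring
  rw [CstarAt, e, add_sub_cancel_left]
  exact onAlphabet_shift Cstar 14 (h - 14) onAlphabet_C (fun c hc f => by have := level_C c hc f; omega)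

theorem axisCell_shiftCell (t : ℤ) (c : Cell) : AxisCell (shiftCell t c) ↔ AxisCell c := by
  simp only [AxisCell, shiftCell, Letter.isAxis, shiftL_x, shiftL_y]

theorem axisRoom_shiftD (t : ℤ) (E : Design) (hR : AxisRoom E) : AxisRoom (shiftD t E) := by
  intro c hc
  rw [suppN_shift, suppP_shift, ← List.map_append] at hc
  obtain ⟨c₀, hc₀, rfl⟩ := List.mem_map.mp hc
  exact (axisCell_shiftCell t c₀).mpr (hR c₀ hc₀)

/-- **THE (A1)-FREE DOOR IS INHABITED IN THE AXIS ROOM WITHIN THE Σ-BUDGET, RULE D INCLUDED**, at every height `h ≥ 2`. -/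
theorem cert_CstarAt {h : ℤ} (hh : 2 ≤ h) :
    (CstarAt h).OnAlphabet h ∧ AxisRoom (CstarAt h) ∧ Disj (CstarAt h) ∧ RuleD (CstarAt h) ∧ HallUp (CstarAt h) ∧
    HallPlusUp (CstarAt h) 8 ∧ (CstarAt h).mu = ⟨-7, 0⟩ ∧ (CstarAt h).rank = 27 ∧ (CstarAt h).copies = 71 ∧
    BudgetClause sigmaH 0 (CstarAt h) := by
  refine ⟨onAlphabet_CstarAt hh, axisRoom_shiftD _ _ axisRoom_C, (disj_shiftD _ _).mpr disj_C, (ruleD_shiftD _ _).mpr ruleD_C,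
    (hallUp_shiftD _ _).mpr hallUp_C, (hallPlusUp_shiftD _ _ 8).mpr hallPlusUp8_C, ?_, ?_, ?_, ?_⟩
  · rw [CstarAt, mu_shiftD, mu_C]
  · rw [CstarAt, rank_shift, rank_C]
  · rw [CstarAt, copies_shift, copies_C]
  · exact (budgetClause_shiftD sigmaH 0 sigmaH_shiftD _ _).mpr budget_C

/-- existence form: the S⁺ sentence of record WITHOUT its (A1) binder is FALSE in the axis room (every `h ≥ 2`), even with `RuleD` and the Σ-budget. -/
theorem not_a1free_door_axisRoom {h : ℤ} (hh : 2 ≤ h) :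
    ¬ (∀ D : Design, D.OnAlphabet h → AxisRoom D → Disj D → RuleD D → HallUp D → HallPlusUp D 8 → D.mu ≠ 0 →
        BudgetClause sigmaH 0 D → False) := by
  intro H
  obtain ⟨hA, hR, hd, hrd, hu, hp, hμ, -, -, hb⟩ := cert_CstarAt hh
  exact H (CstarAt h) hA hR hd hrd hu hp (by rw [hμ]; decide) hb

end Summit.HodgeConjecture.HodgeConjecture.Cruxes.BlochSeedDiscOne.AxisRuleDCheap
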